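import Summits.Ventures.Crystal3D.Theorems.StickyWulffConstantGenericWallFloorCubicCore
import HarnessLib

/-!
# No mixed kissing dozen with at most three foreign balls (I): the contradictory patterns

HONEST FRAMING. Part of the venture `Summits/Ventures/Crystal3D` (cell `crystal3d-full`), helper for the
crux `GenericWallFloor` (stmt-Ventures-19480) of `route-Ventures-StickyWulffConstant`, line `WallLedgerG`:
the kernel version of the NON-SATURATION input (module M5) of the rigid-bicrystal rung of
`stub_twoSlabAdhesion`.  Pure real/integer algebra in cubic coordinates (`…CubicCore`); rung credit only.

ABSTRACT SETTING (shared by this file and the next).  `L` is the set of labels of the EMPTY slots of a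
lattice ball (labels = integer triples with `Σ cᵢ² = 2`), `F` the set of cubic coordinate vectors of the
FOREIGN contact directions (`Σ Dᵢ² = 2`); foreign directions are pairwise at `≥ 60°` (`D · D' ≤ 1`);
every OCCUPIED slot is at `≥ 60°` from every foreign direction (`c · D ≤ 1` for labels `c ∉ L`); every
foreign direction BLOCKS two adjacent empty slots (`c₁ · c₂ = 1`, `cᵢ · D > 1`).  With the empty pair
normalised to `a₀ = (1,1,0)`, `b₀ = (1,0,1)` the following empty sets are CONTRADICTORY:
`{a₀, b₀}` with two foreign directions (`mixedDozen_edge_false`); `{a₀, b₀, ℓ}` with three foreign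
directions for `ℓ = (1,0,−1), (1,−1,0)` (90°-paths, `mixedDozen_tripleA/B_false`),
`ℓ = (0,1,−1), (0,−1,1)` (120°-paths, `mixedDozen_pathA/B_false`) and for `ℓ` adjacent to neither
`a₀` nor `b₀` (`mixedDozen_isolated_false`).  The face `ℓ = (0,1,1)` is the next file.

WHAT THIS IS NOT: no lattice statement yet; rung F-C1 not moved.
-/

noncomputable section

namespace Summit.Ventures.Crystal3D.Theorems

open Finset

/-- Two empty slots `{a₀, b₀}`, two foreign directions: contradiction (the edge pattern). -/
theorem mixedDozen_edge_false
    (L : Finset (Fin 3 → ℤ)) (F : Finset (Fin 3 → ℝ))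
    (hn : ∀ D ∈ F, D 0 ^ 2 + D 1 ^ 2 + D 2 ^ 2 = 2)
    (hsep : ∀ D ∈ F, ∀ D' ∈ F, D ≠ D' → D 0 * D' 0 + D 1 * D' 1 + D 2 * D' 2 ≤ 1)
    (hocc : ∀ D ∈ F, ∀ c : Fin 3 → ℤ, c 0 ^ 2 + c 1 ^ 2 + c 2 ^ 2 = 2 → c ∉ L →
      (c 0 : ℝ) * D 0 + (c 1 : ℝ) * D 1 + (c 2 : ℝ) * D 2 ≤ 1)
    (hblock : ∀ D ∈ F, ∃ c₁ ∈ L, ∃ c₂ ∈ L, c₁ 0 * c₂ 0 + c₁ 1 * c₂ 1 + c₁ 2 * c₂ 2 = 1 ∧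
      1 < (c₁ 0 : ℝ) * D 0 + (c₁ 1 : ℝ) * D 1 + (c₁ 2 : ℝ) * D 2 ∧
      1 < (c₂ 0 : ℝ) * D 0 + (c₂ 1 : ℝ) * D 1 + (c₂ 2 : ℝ) * D 2)
    (D D' : Fin 3 → ℝ) (hD : D ∈ F) (hD' : D' ∈ F) (hDD' : D ≠ D')
    (hLeq : L = {![1, 1, 0], ![1, 0, 1]}) : False := by
  classical
  have hblk : ∀ E ∈ F, 1 < E 0 + E 1 ∧ 1 < E 0 + E 2 := by
    intro E hE
    obtain ⟨c₁, hc₁, c₂, hc₂, hadj, h1, h2⟩ := hblock E hE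
    rw [hLeq] at hc₁ hc₂
    simp only [Finset.mem_insert, Finset.mem_singleton] at hc₁ hc₂
    rcases hc₁ with rfl | rfl <;> rcases hc₂ with rfl | rfl <;>
      simp at hadj h1 h2 ⊢ <;> exact ⟨by linarith, by linarith⟩
  have key : ∀ E ∈ F, (1 < E 0 + E 2) ∧ (E 0 - E 2 ≤ 1) ∧ (E 1 + E 2 ≤ 1) ∧ (-E 1 + E 2 ≤ 1) ∧ (1 < E 0 + E 1) ∧ (E 0 - E 1 ≤ 1) := by
    intro E hE
    have o1 : E 0 - E 2 ≤ 1 := by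
      have h' := hocc E hE ![1, 0, -1] (by decide) (by rw [hLeq]; decide)
      simp at h'; linarith
    have o2 : E 1 + E 2 ≤ 1 := by
      have h' := hocc E hE ![0, 1, 1] (by decide) (by rw [hLeq]; decide)
      simp at h'; linarith
    have o3 : -E 1 + E 2 ≤ 1 := by
      have h' := hocc E hE ![0, -1, 1] (by decide) (by rw [hLeq]; decide)
      simp at h'; linarith
    have o5 : E 0 - E 1 ≤ 1 := by
      have h' := hocc E hE ![1, -1, 0] (by decide) (by rw [hLeq]; decide)
      simp at h'; linarith
    exact ⟨(hblk E hE).2, by linarith [o1], by linarith [o2], by linarith [o3], (hblk E hE).1, by linarith [o5]⟩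
  obtain ⟨k1, k2, k3, k4, k5, k6⟩ := key D hD
  obtain ⟨k1', k2', k3', k4', k5', k6'⟩ := key D' hD'
  exact cubic_edge_false (D 0) (D 1) (D 2) (D' 0) (D' 1) (D' 2) (hn D hD) k1 k2 k3 k4 k5 k6
    (hn D' hD') k1' k2' k3' k4' k5' k6' (hsep D hD D' hD' hDD')

/-- Empty `{a₀, b₀, (1,0,−1)}` (a 90°-path with middle `a₀`), three foreign directions: contradiction. -/
theorem mixedDozen_tripleA_false
    (L : Finset (Fin 3 → ℤ)) (F : Finset (Fin 3 → ℝ))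
    (hn : ∀ D ∈ F, D 0 ^ 2 + D 1 ^ 2 + D 2 ^ 2 = 2)
    (hsep : ∀ D ∈ F, ∀ D' ∈ F, D ≠ D' → D 0 * D' 0 + D 1 * D' 1 + D 2 * D' 2 ≤ 1)
    (hocc : ∀ D ∈ F, ∀ c : Fin 3 → ℤ, c 0 ^ 2 + c 1 ^ 2 + c 2 ^ 2 = 2 → c ∉ L →
      (c 0 : ℝ) * D 0 + (c 1 : ℝ) * D 1 + (c 2 : ℝ) * D 2 ≤ 1)
    (hblock : ∀ D ∈ F, ∃ c₁ ∈ L, ∃ c₂ ∈ L, c₁ 0 * c₂ 0 + c₁ 1 * c₂ 1 + c₁ 2 * c₂ 2 = 1 ∧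
      1 < (c₁ 0 : ℝ) * D 0 + (c₁ 1 : ℝ) * D 1 + (c₁ 2 : ℝ) * D 2 ∧
      1 < (c₂ 0 : ℝ) * D 0 + (c₂ 1 : ℝ) * D 1 + (c₂ 2 : ℝ) * D 2)
    (D₁ D₂ D₃ : Fin 3 → ℝ) (hD₁ : D₁ ∈ F) (hD₂ : D₂ ∈ F) (hD₃ : D₃ ∈ F) (h12 : D₁ ≠ D₂) (h13 : D₁ ≠ D₃)
    (h23 : D₂ ≠ D₃)
    (hLeq : L = {![1, 1, 0], ![1, 0, 1], ![1, 0, -1]}) : False := by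
  classical
  have hblk : ∀ E ∈ F, 1 < E 0 + E 1 := by
    intro E hE
    obtain ⟨c₁, hc₁, c₂, hc₂, hadj, h1, h2⟩ := hblock E hE
    rw [hLeq] at hc₁ hc₂
    simp only [Finset.mem_insert, Finset.mem_singleton] at hc₁ hc₂
    rcases hc₁ with rfl | rfl | rfl <;> rcases hc₂ with rfl | rfl | rfl <;>
      simp at hadj h1 h2 ⊢ <;> linarith
  have key : ∀ E ∈ F, (1 < E 0 + E 1) ∧ (E 0 - E 1 ≤ 1) ∧ (E 2 + E 1 ≤ 1) ∧ (-E 2 + E 1 ≤ 1) := by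
    intro E hE
    have o1 : E 0 - E 1 ≤ 1 := by
      have h' := hocc E hE ![1, -1, 0] (by decide) (by rw [hLeq]; decide)
      simp at h'; linarith
    have o2 : E 1 + E 2 ≤ 1 := by
      have h' := hocc E hE ![0, 1, 1] (by decide) (by rw [hLeq]; decide)
      simp at h'; linarith
    have o3 : E 1 - E 2 ≤ 1 := by
      have h' := hocc E hE ![0, 1, -1] (by decide) (by rw [hLeq]; decide)
      simp at h'; linarith
    exact ⟨hblk E hE, by linarith [o1], by linarith [o2], by linarith [o3]⟩
  obtain ⟨a1, a2, a3, a4⟩ := key D₁ hD₁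
  obtain ⟨b1, b2, b3, b4⟩ := key D₂ hD₂
  obtain ⟨c1, c2, c3, c4⟩ := key D₃ hD₃
  exact cubic_three_false (D₁ 0) (D₁ 2) (D₁ 1) (D₂ 0) (D₂ 2) (D₂ 1) (D₃ 0) (D₃ 2) (D₃ 1)
    (by linear_combination hn D₁ hD₁) a1 a2 a3 a4 (by linear_combination hn D₂ hD₂) b1 b2 b3 b4
    (by linear_combination hn D₃ hD₃) c1 c2 c3 c4
    (by linarith [hsep D₁ hD₁ D₂ hD₂ h12]) (by linarith [hsep D₁ hD₁ D₃ hD₃ h13])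
    (by linarith [hsep D₂ hD₂ D₃ hD₃ h23])

/-- Empty `{a₀, b₀, (1,−1,0)}` (a 90°-path with middle `b₀`), three foreign directions: contradiction. -/
theorem mixedDozen_tripleB_false
    (L : Finset (Fin 3 → ℤ)) (F : Finset (Fin 3 → ℝ))
    (hn : ∀ D ∈ F, D 0 ^ 2 + D 1 ^ 2 + D 2 ^ 2 = 2)
    (hsep : ∀ D ∈ F, ∀ D' ∈ F, D ≠ D' → D 0 * D' 0 + D 1 * D' 1 + D 2 * D' 2 ≤ 1)
    (hocc : ∀ D ∈ F, ∀ c : Fin 3 → ℤ, c 0 ^ 2 + c 1 ^ 2 + c 2 ^ 2 = 2 → c ∉ L →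
      (c 0 : ℝ) * D 0 + (c 1 : ℝ) * D 1 + (c 2 : ℝ) * D 2 ≤ 1)
    (hblock : ∀ D ∈ F, ∃ c₁ ∈ L, ∃ c₂ ∈ L, c₁ 0 * c₂ 0 + c₁ 1 * c₂ 1 + c₁ 2 * c₂ 2 = 1 ∧
      1 < (c₁ 0 : ℝ) * D 0 + (c₁ 1 : ℝ) * D 1 + (c₁ 2 : ℝ) * D 2 ∧
      1 < (c₂ 0 : ℝ) * D 0 + (c₂ 1 : ℝ) * D 1 + (c₂ 2 : ℝ) * D 2)
    (D₁ D₂ D₃ : Fin 3 → ℝ) (hD₁ : D₁ ∈ F) (hD₂ : D₂ ∈ F) (hD₃ : D₃ ∈ F) (h12 : D₁ ≠ D₂) (h13 : D₁ ≠ D₃)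
    (h23 : D₂ ≠ D₃)
    (hLeq : L = {![1, 1, 0], ![1, 0, 1], ![1, -1, 0]}) : False := by
  classical
  have hblk : ∀ E ∈ F, 1 < E 0 + E 2 := by
    intro E hE
    obtain ⟨c₁, hc₁, c₂, hc₂, hadj, h1, h2⟩ := hblock E hE
    rw [hLeq] at hc₁ hc₂
    simp only [Finset.mem_insert, Finset.mem_singleton] at hc₁ hc₂
    rcases hc₁ with rfl | rfl | rfl <;> rcases hc₂ with rfl | rfl | rfl <;>
      simp at hadj h1 h2 ⊢ <;> linarith
  have key : ∀ E ∈ F, (1 < E 0 + E 2) ∧ (E 0 - E 2 ≤ 1) ∧ (E 1 + E 2 ≤ 1) ∧ (-E 1 + E 2 ≤ 1) := by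
    intro E hE
    have o1 : E 0 - E 2 ≤ 1 := by
      have h' := hocc E hE ![1, 0, -1] (by decide) (by rw [hLeq]; decide)
      simp at h'; linarith
    have o2 : E 1 + E 2 ≤ 1 := by
      have h' := hocc E hE ![0, 1, 1] (by decide) (by rw [hLeq]; decide)
      simp at h'; linarith
    have o3 : -E 1 + E 2 ≤ 1 := by
      have h' := hocc E hE ![0, -1, 1] (by decide) (by rw [hLeq]; decide)
      simp at h'; linarith
    exact ⟨hblk E hE, by linarith [o1], by linarith [o2], by linarith [o3]⟩
  obtain ⟨a1, a2, a3, a4⟩ := key D₁ hD₁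
  obtain ⟨b1, b2, b3, b4⟩ := key D₂ hD₂
  obtain ⟨c1, c2, c3, c4⟩ := key D₃ hD₃
  exact cubic_three_false (D₁ 0) (D₁ 1) (D₁ 2) (D₂ 0) (D₂ 1) (D₂ 2) (D₃ 0) (D₃ 1) (D₃ 2)
    (hn D₁ hD₁) a1 a2 a3 a4 (hn D₂ hD₂) b1 b2 b3 b4 (hn D₃ hD₃) c1 c2 c3 c4
    (hsep D₁ hD₁ D₂ hD₂ h12) (hsep D₁ hD₁ D₃ hD₃ h13) (hsep D₂ hD₂ D₃ hD₃ h23)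

/-- Empty `{a₀, b₀, (0,1,−1)}` (a 120°-path with middle `a₀`), three foreign directions: contradiction. -/
theorem mixedDozen_pathA_false
    (L : Finset (Fin 3 → ℤ)) (F : Finset (Fin 3 → ℝ))
    (hn : ∀ D ∈ F, D 0 ^ 2 + D 1 ^ 2 + D 2 ^ 2 = 2)
    (hsep : ∀ D ∈ F, ∀ D' ∈ F, D ≠ D' → D 0 * D' 0 + D 1 * D' 1 + D 2 * D' 2 ≤ 1)
    (hocc : ∀ D ∈ F, ∀ c : Fin 3 → ℤ, c 0 ^ 2 + c 1 ^ 2 + c 2 ^ 2 = 2 → c ∉ L →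
      (c 0 : ℝ) * D 0 + (c 1 : ℝ) * D 1 + (c 2 : ℝ) * D 2 ≤ 1)
    (hblock : ∀ D ∈ F, ∃ c₁ ∈ L, ∃ c₂ ∈ L, c₁ 0 * c₂ 0 + c₁ 1 * c₂ 1 + c₁ 2 * c₂ 2 = 1 ∧
      1 < (c₁ 0 : ℝ) * D 0 + (c₁ 1 : ℝ) * D 1 + (c₁ 2 : ℝ) * D 2 ∧
      1 < (c₂ 0 : ℝ) * D 0 + (c₂ 1 : ℝ) * D 1 + (c₂ 2 : ℝ) * D 2)
    (D₁ D₂ D₃ : Fin 3 → ℝ) (hD₁ : D₁ ∈ F) (hD₂ : D₂ ∈ F) (hD₃ : D₃ ∈ F) (h12 : D₁ ≠ D₂) (h13 : D₁ ≠ D₃)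
    (h23 : D₂ ≠ D₃)
    (hLeq : L = {![1, 1, 0], ![1, 0, 1], ![0, 1, -1]}) : False := by
  classical
  have hblk : ∀ E ∈ F, 1 < E 0 + E 1 ∧ (1 < E 0 + E 2 ∨ 1 < E 1 - E 2) := by
    intro E hE
    obtain ⟨c₁, hc₁, c₂, hc₂, hadj, h1, h2⟩ := hblock E hE
    rw [hLeq] at hc₁ hc₂
    simp only [Finset.mem_insert, Finset.mem_singleton] at hc₁ hc₂
    rcases hc₁ with rfl | rfl | rfl <;> rcases hc₂ with rfl | rfl | rfl <;>
      simp at hadj h1 h2 ⊢ <;> first | exact ⟨by linarith, Or.inl (by linarith)⟩ | exact ⟨by linarith, Or.inr (by linarith)⟩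
  have key : ∀ E ∈ F, (1 < E 0 + E 1) ∧ (E 0 - E 2 ≤ 1) ∧ (E 1 + E 2 ≤ 1) ∧ (-E 1 + E 2 ≤ 1) ∧ (E 0 - E 1 ≤ 1) ∧ (-E 0 - E 2 ≤ 1) ∧ (-E 0 + E 1 ≤ 1) := by
    intro E hE
    have o1 : E 0 - E 2 ≤ 1 := by
      have h' := hocc E hE ![1, 0, -1] (by decide) (by rw [hLeq]; decide)
      simp at h'; linarith
    have o2 : E 1 + E 2 ≤ 1 := by
      have h' := hocc E hE ![0, 1, 1] (by decide) (by rw [hLeq]; decide)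
      simp at h'; linarith
    have o3 : -E 1 + E 2 ≤ 1 := by
      have h' := hocc E hE ![0, -1, 1] (by decide) (by rw [hLeq]; decide)
      simp at h'; linarith
    have o4 : E 0 - E 1 ≤ 1 := by
      have h' := hocc E hE ![1, -1, 0] (by decide) (by rw [hLeq]; decide)
      simp at h'; linarith
    have o5 : -E 0 - E 2 ≤ 1 := by
      have h' := hocc E hE ![-1, 0, -1] (by decide) (by rw [hLeq]; decide)
      simp at h'; linarith
    have o6 : -E 0 + E 1 ≤ 1 := by
      have h' := hocc E hE ![-1, 1, 0] (by decide) (by rw [hLeq]; decide)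
      simp at h'; linarith
    exact ⟨(hblk E hE).1, by linarith [o1], by linarith [o2], by linarith [o3], by linarith [o4], by linarith [o5], by linarith [o6]⟩
  have EP : ∀ E ∈ F, ∀ E' ∈ F, E ≠ E' → 1 < E 0 + E 2 → 1 < E' 0 + E' 2 → False := by
    intro E hE E' hE' hEE' hP hP'
    have k := key E hE
    have k' := key E' hE'
    exact cubic_edge_false (E 0) (E 1) (E 2) (E' 0) (E' 1) (E' 2)
      (by linear_combination hn E hE) (by linarith) (by linarith [k.2.1]) (by linarith [k.2.2.1])
      (by linarith [k.2.2.2.1]) (by linarith [k.1]) (by linarith [k.2.2.2.2.1])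
      (by linear_combination hn E' hE') (by linarith) (by linarith [k'.2.1]) (by linarith [k'.2.2.1])
      (by linarith [k'.2.2.2.1]) (by linarith [k'.1]) (by linarith [k'.2.2.2.2.1])
      (by linarith [hsep E hE E' hE' hEE'])
  have EQ : ∀ E ∈ F, ∀ E' ∈ F, E ≠ E' → 1 < E 1 - E 2 → 1 < E' 1 - E' 2 → False := by
    intro E hE E' hE' hEE' hP hP'
    have k := key E hE
    have k' := key E' hE'
    exact cubic_edge_false (E 1) (E 0) (-E 2) (E' 1) (E' 0) (-E' 2)
      (by linear_combination hn E hE) (by linarith) (by linarith [k.2.2.1]) (by linarith [k.2.1])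
      (by linarith [k.2.2.2.2.2.1]) (by linarith [k.1]) (by linarith [k.2.2.2.2.2.2])
      (by linear_combination hn E' hE') (by linarith) (by linarith [k'.2.2.1]) (by linarith [k'.2.1])
      (by linarith [k'.2.2.2.2.2.1]) (by linarith [k'.1]) (by linarith [k'.2.2.2.2.2.2])
      (by linarith [hsep E hE E' hE' hEE'])
  obtain ⟨-, p1 | q1⟩ := hblk D₁ hD₁ <;> obtain ⟨-, p2 | q2⟩ := hblk D₂ hD₂ <;>
    obtain ⟨-, p3 | q3⟩ := hblk D₃ hD₃
  · exact EP D₁ hD₁ D₂ hD₂ h12 p1 p2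
  · exact EP D₁ hD₁ D₂ hD₂ h12 p1 p2
  · exact EP D₁ hD₁ D₃ hD₃ h13 p1 p3
  · exact EQ D₂ hD₂ D₃ hD₃ h23 q2 q3
  · exact EP D₂ hD₂ D₃ hD₃ h23 p2 p3
  · exact EQ D₁ hD₁ D₃ hD₃ h13 q1 q3
  · exact EQ D₁ hD₁ D₂ hD₂ h12 q1 q2
  · exact EQ D₁ hD₁ D₂ hD₂ h12 q1 q2

/-- Empty `{a₀, b₀, (0,−1,1)}` (a 120°-path with middle `b₀`), three foreign directions: contradiction. -/
theorem mixedDozen_pathB_false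
    (L : Finset (Fin 3 → ℤ)) (F : Finset (Fin 3 → ℝ))
    (hn : ∀ D ∈ F, D 0 ^ 2 + D 1 ^ 2 + D 2 ^ 2 = 2)
    (hsep : ∀ D ∈ F, ∀ D' ∈ F, D ≠ D' → D 0 * D' 0 + D 1 * D' 1 + D 2 * D' 2 ≤ 1)
    (hocc : ∀ D ∈ F, ∀ c : Fin 3 → ℤ, c 0 ^ 2 + c 1 ^ 2 + c 2 ^ 2 = 2 → c ∉ L →
      (c 0 : ℝ) * D 0 + (c 1 : ℝ) * D 1 + (c 2 : ℝ) * D 2 ≤ 1)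
    (hblock : ∀ D ∈ F, ∃ c₁ ∈ L, ∃ c₂ ∈ L, c₁ 0 * c₂ 0 + c₁ 1 * c₂ 1 + c₁ 2 * c₂ 2 = 1 ∧
      1 < (c₁ 0 : ℝ) * D 0 + (c₁ 1 : ℝ) * D 1 + (c₁ 2 : ℝ) * D 2 ∧
      1 < (c₂ 0 : ℝ) * D 0 + (c₂ 1 : ℝ) * D 1 + (c₂ 2 : ℝ) * D 2)
    (D₁ D₂ D₃ : Fin 3 → ℝ) (hD₁ : D₁ ∈ F) (hD₂ : D₂ ∈ F) (hD₃ : D₃ ∈ F) (h12 : D₁ ≠ D₂) (h13 : D₁ ≠ D₃)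
    (h23 : D₂ ≠ D₃)
    (hLeq : L = {![1, 1, 0], ![1, 0, 1], ![0, -1, 1]}) : False := by
  classical
  have hblk : ∀ E ∈ F, 1 < E 0 + E 2 ∧ (1 < E 0 + E 1 ∨ 1 < -E 1 + E 2) := by
    intro E hE
    obtain ⟨c₁, hc₁, c₂, hc₂, hadj, h1, h2⟩ := hblock E hE
    rw [hLeq] at hc₁ hc₂
    simp only [Finset.mem_insert, Finset.mem_singleton] at hc₁ hc₂
    rcases hc₁ with rfl | rfl | rfl <;> rcases hc₂ with rfl | rfl | rfl <;>
      simp at hadj h1 h2 ⊢ <;> first | exact ⟨by linarith, Or.inl (by linarith)⟩ | exact ⟨by linarith, Or.inr (by linarith)⟩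
  have key : ∀ E ∈ F, (1 < E 0 + E 2) ∧ (E 0 - E 1 ≤ 1) ∧ (E 2 + E 1 ≤ 1) ∧ (-E 2 + E 1 ≤ 1) ∧ (E 0 - E 2 ≤ 1) ∧ (-E 0 - E 1 ≤ 1) ∧ (-E 0 + E 2 ≤ 1) := by
    intro E hE
    have o1 : E 0 - E 1 ≤ 1 := by
      have h' := hocc E hE ![1, -1, 0] (by decide) (by rw [hLeq]; decide)
      simp at h'; linarith
    have o2 : E 1 + E 2 ≤ 1 := by
      have h' := hocc E hE ![0, 1, 1] (by decide) (by rw [hLeq]; decide)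
      simp at h'; linarith
    have o3 : E 1 - E 2 ≤ 1 := by
      have h' := hocc E hE ![0, 1, -1] (by decide) (by rw [hLeq]; decide)
      simp at h'; linarith
    have o4 : E 0 - E 2 ≤ 1 := by
      have h' := hocc E hE ![1, 0, -1] (by decide) (by rw [hLeq]; decide)
      simp at h'; linarith
    have o5 : -E 0 - E 1 ≤ 1 := by
      have h' := hocc E hE ![-1, -1, 0] (by decide) (by rw [hLeq]; decide)
      simp at h'; linarith
    have o6 : -E 0 + E 2 ≤ 1 := by
      have h' := hocc E hE ![-1, 0, 1] (by decide) (by rw [hLeq]; decide)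
      simp at h'; linarith
    exact ⟨(hblk E hE).1, by linarith [o1], by linarith [o2], by linarith [o3], by linarith [o4], by linarith [o5], by linarith [o6]⟩
  have EP : ∀ E ∈ F, ∀ E' ∈ F, E ≠ E' → 1 < E 0 + E 1 → 1 < E' 0 + E' 1 → False := by
    intro E hE E' hE' hEE' hP hP'
    have k := key E hE
    have k' := key E' hE'
    exact cubic_edge_false (E 0) (E 2) (E 1) (E' 0) (E' 2) (E' 1)
      (by linear_combination hn E hE) (by linarith) (by linarith [k.2.1]) (by linarith [k.2.2.1])
      (by linarith [k.2.2.2.1]) (by linarith [k.1]) (by linarith [k.2.2.2.2.1])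
      (by linear_combination hn E' hE') (by linarith) (by linarith [k'.2.1]) (by linarith [k'.2.2.1])
      (by linarith [k'.2.2.2.1]) (by linarith [k'.1]) (by linarith [k'.2.2.2.2.1])
      (by linarith [hsep E hE E' hE' hEE'])
  have EQ : ∀ E ∈ F, ∀ E' ∈ F, E ≠ E' → 1 < -E 1 + E 2 → 1 < -E' 1 + E' 2 → False := by
    intro E hE E' hE' hEE' hP hP'
    have k := key E hE
    have k' := key E' hE'
    exact cubic_edge_false (E 2) (E 0) (-E 1) (E' 2) (E' 0) (-E' 1)
      (by linear_combination hn E hE) (by linarith) (by linarith [k.2.2.1]) (by linarith [k.2.1])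
      (by linarith [k.2.2.2.2.2.1]) (by linarith [k.1]) (by linarith [k.2.2.2.2.2.2])
      (by linear_combination hn E' hE') (by linarith) (by linarith [k'.2.2.1]) (by linarith [k'.2.1])
      (by linarith [k'.2.2.2.2.2.1]) (by linarith [k'.1]) (by linarith [k'.2.2.2.2.2.2])
      (by linarith [hsep E hE E' hE' hEE'])
  obtain ⟨-, p1 | q1⟩ := hblk D₁ hD₁ <;> obtain ⟨-, p2 | q2⟩ := hblk D₂ hD₂ <;>
    obtain ⟨-, p3 | q3⟩ := hblk D₃ hD₃
  · exact EP D₁ hD₁ D₂ hD₂ h12 p1 p2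
  · exact EP D₁ hD₁ D₂ hD₂ h12 p1 p2
  · exact EP D₁ hD₁ D₃ hD₃ h13 p1 p3
  · exact EQ D₂ hD₂ D₃ hD₃ h23 q2 q3
  · exact EP D₂ hD₂ D₃ hD₃ h23 p2 p3
  · exact EQ D₁ hD₁ D₃ hD₃ h13 q1 q3
  · exact EQ D₁ hD₁ D₂ hD₂ h12 q1 q2
  · exact EQ D₁ hD₁ D₂ hD₂ h12 q1 q2

/-- Empty `{a₀, b₀, ℓ}` with `ℓ` adjacent to neither `a₀` nor `b₀` (and `ℓ` none of the four labels
`(1,0,−1), (0,1,1), (0,−1,1), (1,−1,0)` — automatic, they are adjacent to `a₀` or `b₀`), two distinct foreign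
directions: contradiction (both block the edge `a₀ b₀`). -/
theorem mixedDozen_isolated_false
    (L : Finset (Fin 3 → ℤ)) (F : Finset (Fin 3 → ℝ))
    (hn : ∀ D ∈ F, D 0 ^ 2 + D 1 ^ 2 + D 2 ^ 2 = 2)
    (hsep : ∀ D ∈ F, ∀ D' ∈ F, D ≠ D' → D 0 * D' 0 + D 1 * D' 1 + D 2 * D' 2 ≤ 1)
    (hocc : ∀ D ∈ F, ∀ c : Fin 3 → ℤ, c 0 ^ 2 + c 1 ^ 2 + c 2 ^ 2 = 2 → c ∉ L →
      (c 0 : ℝ) * D 0 + (c 1 : ℝ) * D 1 + (c 2 : ℝ) * D 2 ≤ 1)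
    (hblock : ∀ D ∈ F, ∃ c₁ ∈ L, ∃ c₂ ∈ L, c₁ 0 * c₂ 0 + c₁ 1 * c₂ 1 + c₁ 2 * c₂ 2 = 1 ∧
      1 < (c₁ 0 : ℝ) * D 0 + (c₁ 1 : ℝ) * D 1 + (c₁ 2 : ℝ) * D 2 ∧
      1 < (c₂ 0 : ℝ) * D 0 + (c₂ 1 : ℝ) * D 1 + (c₂ 2 : ℝ) * D 2)
    (D D' : Fin 3 → ℝ) (hD : D ∈ F) (hD' : D' ∈ F) (hDD' : D ≠ D')
    (ℓ : Fin 3 → ℤ) (hLeq : L = {![1, 1, 0], ![1, 0, 1], ℓ})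
    (hℓa : ℓ 0 + ℓ 1 ≠ 1) (hℓb : ℓ 0 + ℓ 2 ≠ 1) (hℓℓ : ℓ 0 * ℓ 0 + ℓ 1 * ℓ 1 + ℓ 2 * ℓ 2 ≠ 1)
    (hn1 : (![1, 0, -1] : Fin 3 → ℤ) ∉ L) (hn2 : (![0, 1, 1] : Fin 3 → ℤ) ∉ L) (hn3 : (![0, -1, 1] : Fin 3 → ℤ) ∉ L)
    (hn4 : (![1, -1, 0] : Fin 3 → ℤ) ∉ L) : False := by
  classical
  have hblk : ∀ E ∈ F, 1 < E 0 + E 1 ∧ 1 < E 0 + E 2 := by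
    intro E hE
    obtain ⟨c₁, hc₁, c₂, hc₂, hadj, h1, h2⟩ := hblock E hE
    rw [hLeq] at hc₁ hc₂
    simp only [Finset.mem_insert, Finset.mem_singleton] at hc₁ hc₂
    rcases hc₁ with rfl | rfl | rfl <;> rcases hc₂ with rfl | rfl | rfl <;>
      (try simp at hadj h1 h2 ⊢) <;>
      first | exact ⟨by linarith, by linarith⟩ | exact absurd hadj hℓℓ | (exfalso; omega)
  have o1 : D 0 - D 2 ≤ 1 := by
    have h' := hocc D hD ![1, 0, -1] (by decide) hn1
    simp at h'; linarith
  have o2 : D 1 + D 2 ≤ 1 := by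
    have h' := hocc D hD ![0, 1, 1] (by decide) hn2
    simp at h'; linarith
  have o3 : -D 1 + D 2 ≤ 1 := by
    have h' := hocc D hD ![0, -1, 1] (by decide) hn3
    simp at h'; linarith
  have o4 : D 0 - D 1 ≤ 1 := by
    have h' := hocc D hD ![1, -1, 0] (by decide) hn4
    simp at h'; linarith
  have o1' : D' 0 - D' 2 ≤ 1 := by
    have h' := hocc D' hD' ![1, 0, -1] (by decide) hn1
    simp at h'; linarith
  have o2' : D' 1 + D' 2 ≤ 1 := by
    have h' := hocc D' hD' ![0, 1, 1] (by decide) hn2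
    simp at h'; linarith
  have o3' : -D' 1 + D' 2 ≤ 1 := by
    have h' := hocc D' hD' ![0, -1, 1] (by decide) hn3
    simp at h'; linarith
  have o4' : D' 0 - D' 1 ≤ 1 := by
    have h' := hocc D' hD' ![1, -1, 0] (by decide) hn4
    simp at h'; linarith
  obtain ⟨b1, b2⟩ := hblk D hD
  obtain ⟨b1', b2'⟩ := hblk D' hD'
  exact cubic_edge_false (D 0) (D 1) (D 2) (D' 0) (D' 1) (D' 2) (hn D hD) b2 (by linarith [o1]) (by linarith [o2])
    (by linarith [o3]) b1 (by linarith [o4]) (hn D' hD') b2' (by linarith [o1']) (by linarith [o2']) (by linarith [o3'])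
    b1' (by linarith [o4']) (hsep D hD D' hD' hDD')

end Summit.Ventures.Crystal3D.Theorems

end
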